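import Summits.MatrixMultiplication.OmegaCensus.SmallFormats.GF2OrbitSweepLPSplit
import HarnessLib

/-!
# ω-census family (a), GF(2) rank floors: FAST replay of LP-DFS rounds, part 1 (oracle monotonicity, value trees, chunked lookups)

Cell `pub-mm22` (MatrixMultiplication venture, Route D3-STRETCH `20 ≤ R_𝔽₂(⟨3,3,3⟩)`, seat p3 g3), topic
`Summits/MatrixMultiplication/OmegaCensus` (sub-folder `SmallFormats`, next to `GF2OrbitSweepLP.lean`). HONEST FRAMING:
checker PLUMBING, PROVED (0 sorry); no bound is claimed here and nothing is progress on `ω`.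

The landed replay of an LP-DFS round (`StepX.dfsLP`, `RootsOKX`, `MCert.check`, `lpLeafMB`) asks the kernel, for every
row of every LP leaf, to evaluate the oracle `fun fm => lbOf2 osC table tableT (setOf N fm)`: a round trip mask → `Finset`
→ mask (`maskOfF ∘ setOf`, quadratic in `N`) followed by a LINEAR `List.find?` over lookup tables of up to 2,800 rows.
For the four heavy orbits of the `⟨3,3,3⟩` chain (`N = 63 / 127`, 10³–4·10⁴ rows) this exceeds the gate's budget.
This file (and `GF2FastLeaf.lean`, `GF2FastTable.lean`) prove that the SAME landed predicates follow from cheaper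
Boolean facts:

* `MCert.check` is MONOTONE in the oracle (`MCert.check_mono`), so any pointwise smaller oracle may be used;
* `VTree` — a binary search tree `mask ↦ value` emitted per orbit; `VTree.find_le`: if every node passes a local test
  implying `val ≤ G key`, then `find ≤ G` everywhere (misses return `0`);
* the local test `hintOK` for `G = lbOf2 osC table tableT ∘ setOf N`: the node names a row of one of the two key-sorted
  (`keysAscB`) tables; `find?` on a key-sorted table hits that row (`find?_eq_getElem_of_keysAscB`), and
  `maskOfF (setOf N fm) = fm` for `fm < 2^N` (`maskOfF_setOf`);
* `chunk` / `getC?` — two-level (block) access to long list literals, `getC?_eq : getC? l w i = l[i]?`, so that the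
  kernel never walks thousands of cons cells per lookup;
* `bitB` — the bit test through the kernel-accelerated `Nat.shiftRight` / `Nat.land` / `Nat.beq` (`bitB_eq_testBit`);
* gluing of chunked facts without arithmetic in types (`allRange_append`, `forall_lt_of_allRange_zero`, `forall_lt_succ'`).
-/

namespace Summit.MatrixMultiplication.OmegaCensus.GF2RankLB

open Literature.Computability.AlgebraicComplexity

/-! ## Monotonicity of the replay in the `LB` oracle -/

section Mono

variable {N : ℕ} {LB₁ LB₂ : ℕ → ℕ}

/-- The LP-leaf test is monotone in the oracle. -/
theorem lpLeafMB_mono (hle : ∀ fm, LB₁ fm ≤ LB₂ fm) {target : ℕ} {rows : List (ℕ × ℕ)} {D d : ℕ}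
    {s : Fin d → Fin N} (h : lpLeafMB LB₁ target rows D d s = true) :
    lpLeafMB LB₂ target rows D d s = true := by
  simp only [lpLeafMB, Bool.and_eq_true, decide_eq_true_eq] at h ⊢
  refine ⟨h.1, lt_of_lt_of_le h.2 (Nat.add_le_add_right (Finset.sum_le_sum fun j _ => ?_) _)⟩
  exact Nat.mul_le_mul_left _ (Nat.add_le_add_right (hle _) _)

/-- The tree replay is monotone in the oracle. -/
theorem MCert.check_mono (hle : ∀ fm, LB₁ fm ≤ LB₂ fm) {target maxDepth : ℕ} :
    ∀ (t : MCert N) (d : ℕ) (s : Fin d → Fin N),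
      t.check LB₁ target maxDepth d s = true → t.check LB₂ target maxDepth d s = true
  | .leaf rows D, d, s, h => by
    simp only [MCert.check] at h ⊢
    exact lpLeafMB_mono hle h
  | .node cs, d, s, h => by
    simp only [MCert.check, Bool.and_eq_true, decide_eq_true_eq] at h ⊢
    exact ⟨h.1, fun m hm => MCert.check_mono hle (cs m) (d + 1) (Fin.snoc s m) (h.2 m hm)⟩

end Mono

/-! ## Value trees -/

/-- A binary search tree `mask ↦ value`; `hint` is checker data (which table, which row). -/
inductive VTree : Type
  | nil : VTree
  | br (lo : VTree) (key val hint : ℕ) (hi : VTree) : VTree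

namespace VTree

/-- Lookup (`0` when absent). -/
def find : VTree → ℕ → ℕ
  | nil, _ => 0
  | br lo key val _ hi, fm =>
      bif Nat.blt fm key then lo.find fm else bif Nat.beq fm key then val else hi.find fm

/-- Every node passes `p key val hint`. -/
def allB (p : ℕ → ℕ → ℕ → Bool) : VTree → Bool
  | nil => true
  | br lo key val hint hi => p key val hint && (lo.allB p && hi.allB p)

/-- **Soundness of the value tree**: if every node's test implies `val ≤ G key`, then `find ≤ G`. -/
theorem find_le {G : ℕ → ℕ} {p : ℕ → ℕ → ℕ → Bool} (hp : ∀ k v h, p k v h = true → v ≤ G k) :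
    ∀ t : VTree, t.allB p = true → ∀ fm, t.find fm ≤ G fm
  | nil, _, _ => Nat.zero_le _
  | br lo key val hint hi, h, fm => by
    simp only [allB, Bool.and_eq_true] at h
    obtain ⟨hk, hlo, hhi⟩ := h
    unfold find
    cases Nat.blt fm key
    · cases he : Nat.beq fm key
      · exact find_le hp hi hhi fm
      · have hfm : fm = key := Nat.eq_of_beq_eq_true he
        rw [hfm]
        exact hp _ _ _ hk
    · exact find_le hp lo hlo fm

end VTree

/-! ## Key-sorted lookup tables -/

/-- Keys strictly increasing. -/
def keysAscB : List LookRow → Bool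
  | [] => true
  | [_] => true
  | e :: e' :: rest => Nat.blt e.1 e'.1 && keysAscB (e' :: rest)

/-- Tail and head bound of a key-sorted table. -/
theorem keysAscB_cons {e : LookRow} {t : List LookRow} (h : keysAscB (e :: t) = true) :
    keysAscB t = true ∧ ∀ x ∈ t, e.1 < x.1 := by
  induction t generalizing e with
  | nil => simp [keysAscB]
  | cons e' rest ih =>
    simp only [keysAscB, Bool.and_eq_true, Nat.blt_eq] at h
    obtain ⟨h1, h2⟩ := h
    refine ⟨h2, fun x hx => ?_⟩
    rcases List.mem_cons.1 hx with rfl | hx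
    · exact h1
    · exact lt_trans h1 ((ih h2).2 x hx)

/-- In a key-sorted table, `find?` by key hits the indexed row. -/
theorem find?_eq_getElem_of_keysAscB : ∀ (t : List LookRow), keysAscB t = true →
    ∀ (i : ℕ) (hi : i < t.length), t.find? (fun e => e.1 == (t[i]).1) = some t[i]
  | [], _, i, hi => absurd hi (Nat.not_lt_zero _)
  | e :: rest, h, 0, _ => by simp
  | e :: rest, h, i + 1, hi => by
    have hr := keysAscB_cons h
    have hi' : i < rest.length := by simpa using hi
    have hlt : e.1 < (rest[i]).1 := hr.2 _ (List.getElem_mem hi')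
    rw [List.getElem_cons_succ, List.find?_cons_of_neg (by simpa using Nat.ne_of_lt hlt)]
    exact find?_eq_getElem_of_keysAscB rest hr.1 i hi'

/-- The lookup value at the key of row `i` of a key-sorted table is that row's orbit bound. -/
theorem lookVal_getElem (osC : List Orbit) {t : List LookRow} (h : keysAscB t = true) (i : ℕ)
    (hi : i < t.length) : lookVal osC t (t[i]).1 = bnd osC (t[i]).2.1 := by
  simp only [lookVal, find?_eq_getElem_of_keysAscB t h i hi]

/-! ## Masks round trip -/

/-- `maskOfF ∘ setOf N` is the identity below `2^N`. -/
theorem maskOfF_setOf {N fm : ℕ} (hfm : fm < 2 ^ N) : maskOfF (setOf N fm) = fm := by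
  apply Nat.eq_of_testBit_eq
  intro i
  by_cases hi : i < N
  · rw [show i = ((⟨i, hi⟩ : Fin N) : ℕ) from rfl, testBit_maskOfF, decide_mem_setOf]
  · have h2 : 2 ^ N ≤ 2 ^ i := Nat.pow_le_pow_right (by norm_num) (le_of_not_gt hi)
    have h1 : maskOfF (setOf N fm) < 2 ^ N := maskOf_lt _ _
    rw [Nat.testBit_lt_two_pow (lt_of_lt_of_le h1 h2), Nat.testBit_lt_two_pow (lt_of_lt_of_le hfm h2)]

/-! ## Chunked (two-level) access to long list literals -/

section Chunk

variable {α : Type*}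

/-- `f` blocks of width `w` (the last ones possibly short or empty). -/
def chunk (w : ℕ) : ℕ → List α → List (List α)
  | 0, _ => []
  | f + 1, l => l.take w :: chunk w f (l.drop w)

/-- Block access: element `i` through block `i / w`, offset `i % w`. -/
theorem chunk_getElem? {w : ℕ} (hw : 0 < w) : ∀ (f : ℕ) (l : List α) (i : ℕ), l.length ≤ f * w →
    ((chunk w f l).getD (i / w) [])[i % w]? = l[i]?
  | 0, l, i, hl => by
    have : l = [] := List.eq_nil_of_length_eq_zero (Nat.le_zero.1 (by simpa using hl))
    subst this
    simp [chunk]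
  | f + 1, l, i, hl => by
    rw [chunk]
    by_cases hi : i < w
    · rw [Nat.div_eq_of_lt hi, Nat.mod_eq_of_lt hi, List.getD_cons_zero, List.getElem?_take, if_pos hi]
    · have hwi : w ≤ i := le_of_not_gt hi
      rw [Nat.div_eq_sub_div hw hwi, Nat.mod_eq_sub_mod hwi, List.getD_cons_succ,
        chunk_getElem? hw f (l.drop w) (i - w) (by rw [List.length_drop, Nat.succ_mul] at *; omega),
        List.getElem?_drop, Nat.add_sub_cancel' hwi]

/-- Two-level access to a list (block width `w`), `Option`-valued. -/
def getC? (l : List α) (w i : ℕ) : Option α := ((chunk w (l.length / w + 1) l).getD (i / w) [])[i % w]?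

/-- `getC?` is `l[i]?`. -/
theorem getC?_eq (l : List α) {w : ℕ} (hw : 0 < w) (i : ℕ) : getC? l w i = l[i]? :=
  chunk_getElem? hw _ l i (by have := Nat.lt_div_mul_add hw (a := l.length); rw [Nat.succ_mul]; omega)

end Chunk

/-! ## Certified value-tree entries -/

/-- Local test of a value-tree node: `key < 2^N`, and row `h / 2` of the plain (`h` even) or transposed (`h` odd)
table (read through 64-blocks) has mask `key` and an orbit whose claimed bound is `≥ val`. -/
def hintOK (osC : List Orbit) (tb tt : List LookRow) (N key val h : ℕ) : Bool :=
  Nat.blt key (2 ^ N) &&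
    match getC? (bif Nat.beq (h % 2) 0 then tb else tt) 64 (h / 2) with
    | some e => Nat.beq e.1 key && Nat.ble val (bnd osC e.2.1)
    | none => false

/-- A row with the right mask bounds the lookup from below (key-sorted table). -/
theorem le_lookVal_of_row (osC : List Orbit) {t : List LookRow} (ht : keysAscB t = true) {j key val : ℕ}
    (h : (match t[j]? with
      | some e => Nat.beq e.1 key && Nat.ble val (bnd osC e.2.1)
      | none => false) = true) : val ≤ lookVal osC t key := by
  split at h
  · next e he =>
    simp only [Bool.and_eq_true, Nat.beq_eq, Nat.ble_eq] at h
    obtain ⟨hj, hje⟩ := List.getElem?_eq_some_iff.1 he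
    obtain ⟨hek, hval⟩ := h
    rw [← hek, ← hje, lookVal_getElem osC ht j hj, hje]
    exact hval
  · exact absurd h Bool.false_ne_true

/-- **Soundness of `hintOK`.** -/
theorem le_lbOf2_of_hintOK (osC : List Orbit) {tb tt : List LookRow} (hb : keysAscB tb = true)
    (ht : keysAscB tt = true) {N key val h : ℕ} (hok : hintOK osC tb tt N key val h = true) :
    val ≤ lbOf2 osC tb tt (setOf N key) := by
  unfold hintOK at hok
  rw [Bool.and_eq_true, Nat.blt_eq, getC?_eq _ (by decide)] at hok
  obtain ⟨hkey, hm⟩ := hok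
  unfold lbOf2 lbOf
  rw [maskOfF_setOf hkey]
  cases hs : Nat.beq (h % 2) 0
  · rw [hs] at hm
    exact le_max_of_le_right (le_lookVal_of_row osC ht hm)
  · rw [hs] at hm
    exact le_max_of_le_left (le_lookVal_of_row osC hb hm)

/-! ## Fast bit test -/

/-- Bit `n` of `m`, through kernel-accelerated primitives only. -/
def bitB (m n : ℕ) : Bool := Nat.beq (Nat.land (Nat.shiftRight m n) 1) 1

/-- `bitB` is `Nat.testBit`. -/
theorem bitB_eq_testBit (m n : ℕ) : bitB m n = m.testBit n := by
  have h1 : Nat.land (Nat.shiftRight m n) 1 = m / 2 ^ n % 2 := by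
    rw [← Nat.shiftRight_eq_div_pow]
    exact Nat.and_one_is_mod _
  rw [bitB, h1, Nat.testBit_eq_decide_div_mod_eq]
  cases h : Nat.beq (m / 2 ^ n % 2) 1
  · have := Nat.ne_of_beq_eq_false h
    simp [this]
  · have := Nat.eq_of_beq_eq_true h
    simp [this]

/-! ## Gluing chunked facts (no arithmetic left to unification) -/

/-- Concatenating two `allRange` facts. -/
theorem allRange_adj {p : ℕ → Bool} {lo a b : ℕ} (h1 : allRange p lo a = true)
    (h2 : allRange p (lo + a) b = true) : allRange p lo (a + b) = true := by
  induction a generalizing lo with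
  | zero => simpa using h2
  | succ a ih =>
    rw [allRange, Bool.and_eq_true] at h1
    rw [Nat.add_right_comm, allRange, Bool.and_eq_true]
    exact ⟨h1.1, ih h1.2 (by rwa [Nat.add_assoc, Nat.add_comm 1 a])⟩

/-- Concatenation with the bounds as explicit numerals (`e₁`, `e₂` are closed arithmetic, proved by `rfl`). -/
theorem allRange_append {p : ℕ → Bool} {lo a lo' b n : ℕ} (h1 : allRange p lo a = true)
    (h2 : allRange p lo' b = true) (e₁ : lo + a = lo') (e₂ : a + b = n) : allRange p lo n = true := by
  subst e₁ e₂
  exact allRange_adj h1 h2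

/-- `allRange p 0 n` gives `p` below `n`. -/
theorem forall_lt_of_allRange_zero {p : ℕ → Bool} {n : ℕ} (h : allRange p 0 n = true) : ∀ x < n, p x = true :=
  fun x hx => allRange_spec p n 0 h x (Nat.zero_le x) (by simpa using hx)

/-- Nothing below `0`. -/
theorem forall_lt_zero' (P : ℕ → Prop) : ∀ j < 0, P j := fun j hj => absurd hj (Nat.not_lt_zero j)

/-- One more case, with the successor as an explicit numeral (`e` proved by `rfl`). -/
theorem forall_lt_succ' (P : ℕ → Prop) (n m : ℕ) (e : n + 1 = m) (h1 : ∀ j < n, P j) (h2 : P n) :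
    ∀ j < m, P j := by
  subst e
  intro j hj
  rcases Nat.lt_succ_iff_lt_or_eq.1 hj with h | rfl
  · exact h1 j h
  · exact h2

end Summit.MatrixMultiplication.OmegaCensus.GF2RankLB
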